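import Mathlib
import HarnessLib
import Summits.FinalStateConjecture.Statement
import Literature.Geometry.Lorentzian.LandauLifshitzPseudotensor
import Summits.FinalStateConjecture.FinalStateConjecture.Theorems.InertialRecession.Negative.PaintingRigidityStabiliser
import Literature.Geometry.Lorentzian.KerrConvergenceProofs

/-!
# Route EIHFluxBalance — `InertialRecession`, re-charting: a timelike field on the Kerr exterior

Helper file for the crux `stmt-FinalStateConjecture-10166`
(`Summit.FinalStateConjecture.FinalStateConjecture.Theses.EIHFluxBalance.InertialRecession`),
line `sublinear-is-free-clean-window-charges`, stub `stub_rechart` (the transfer P2), part G2.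

The exhaustion clause of the transfer needs, inside every near zone, future timelike curves along
which the hole time `t*` increases while the Kerr–Schild radius stays fixed ("forward hole-time
flow"). The stationary field `∂_{t*}` fails inside the ergoregion. We use instead the **Carter
field** `χ = ∂_{t*} + a/(r² + a²) ∂_φ` (the time leg of Carter's canonical tetrad, proportional to
the sum of the two principal null directions), written in Kerr–Schild Cartesian coordinates as
`χ(x) = e₀ + (a/(r²+a²)) (x¹ e₂ − x² e₁)`. Main results:

* `carterField`, `kerr_bilin_carterField` — the exact identity
  `g_{M,a}(χ, χ) = −(r⁴ + a²z²)/(r²(r²+a²)) · Δ(r)/(r²+a²)`, `Δ(r) = r² − 2Mr + a²`, at every point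
  with `r > 0` (from the defining quartic of `r`): `χ` is timelike exactly where `Δ > 0`;
* `kerr_bilin_carterField_le` — the uniform bound `g(χ,χ) ≤ −r²Δ/(r²+a²)²` when `Δ ≥ 0`;
* `kerrDelta_div_mono` — `r ↦ Δ(r)/(r²+a²)` is monotone on `[|a|, ∞) ∩ (0, ∞)`, whence a margin
  that is uniform on `{r ≥ r₊ + δ}`;
* `norm_carterField_sq_le` — `‖χ‖² ≤ 2`.

[cite: Carter1968, (canonical tetrad)] [folklore: Visser arXiv:0706.0622, §5]
-/

noncomputable section

set_option linter.dupNamespace false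

open Set Filter Function
open scoped Topology
open Literature.Geometry.Lorentzian

namespace Summit.FinalStateConjecture.FinalStateConjecture.Theorems.SublinearIsFree.Rechart

/-- The **Carter field** `χ(x) = e₀ + (a/(r²+a²)) (x¹ e₂ − x² e₁)` of the Kerr–Schild chart
(`r = Kerr.radius a x`): `∂_{t*} + a/(r²+a²) ∂_φ`. [cite: Carter1968] -/
def carterField (a : ℝ) (x : E4) : E4 :=
  E4.basisVector 0 + (a / (Kerr.radius a x ^ 2 + a ^ 2)) •
    ((x 1) • E4.basisVector 2 - (x 2) • E4.basisVector 1)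

/-- Components of the Carter field. [folklore] -/
theorem carterField_apply (a : ℝ) (x : E4) :
    carterField a x 0 = 1 ∧ carterField a x 1 = -(a / (Kerr.radius a x ^ 2 + a ^ 2) * x 2) ∧
      carterField a x 2 = a / (Kerr.radius a x ^ 2 + a ^ 2) * x 1 ∧ carterField a x 3 = 0 := by
  refine ⟨?_, ?_, ?_, ?_⟩ <;> simp [carterField, Fin.ext_iff]

/-- `η(χ, χ) = −1 + (a/(r²+a²))² (x₁² + x₂²)`. [folklore] -/
theorem minkowski_carterField (a : ℝ) (x : E4) :
    Minkowski.bilin (carterField a x) (carterField a x) =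
      -1 + (a / (Kerr.radius a x ^ 2 + a ^ 2)) ^ 2 * (x 1 ^ 2 + x 2 ^ 2) := by
  obtain ⟨h0, h1, h2, h3⟩ := carterField_apply a x
  rw [Minkowski.bilin_apply, Fin.sum_univ_three]
  simp only [Fin.succ_zero_eq_one, Fin.succ_one_eq_two]
  rw [show (2 : Fin 3).succ = (3 : Fin 4) from rfl, h0, h1, h2, h3]
  ring

/-- `ℓ(χ) = 1 − a²(x₁² + x₂²)/(r²+a²)²`. [folklore] -/
theorem nullCovector_carterField (a : ℝ) (x : E4) :
    Kerr.nullCovector a x (carterField a x) =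
      1 - a ^ 2 * (x 1 ^ 2 + x 2 ^ 2) / (Kerr.radius a x ^ 2 + a ^ 2) ^ 2 := by
  obtain ⟨h0, h1, h2, h3⟩ := carterField_apply a x
  rcases eq_or_ne (Kerr.radius a x ^ 2 + a ^ 2) 0 with h | h
  · rw [h] at h1 h2
    simp only [div_zero, zero_mul, neg_zero] at h1 h2
    simp only [Kerr.nullCovector, Kerr.nullCovectorFun, E4.covector_apply, Fin.sum_univ_four,
      Fin.isValue, Matrix.cons_val_zero, Matrix.cons_val_one, Matrix.cons_val, h0, h1, h2, h3, h]
    simp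
  · simp only [Kerr.nullCovector, Kerr.nullCovectorFun, E4.covector_apply, Fin.sum_univ_four,
      Fin.isValue, Matrix.cons_val_zero, Matrix.cons_val_one, Matrix.cons_val, h0, h1, h2, h3]
    field_simp
    ring

/-- The key coordinate identity `(x₁² + x₂²) r² = (r² + a²)(r² − x₃²)` (the defining quartic of the
Kerr–Schild radius, `Kerr.radius_quartic`, rearranged). [folklore] -/
theorem varpi_sq_mul_radius_sq (a : ℝ) (x : E4) :
    (x 1 ^ 2 + x 2 ^ 2) * Kerr.radius a x ^ 2 =
      (Kerr.radius a x ^ 2 + a ^ 2) * (Kerr.radius a x ^ 2 - x 3 ^ 2) := by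
  have hq := Kerr.radius_quartic a x
  rw [E4.spatialNorm_sq] at hq
  linear_combination -hq

/-- **The Carter field identity.** At every point with `r > 0`:
`g_{M,a}(χ, χ) = −((r⁴ + a²x₃²)/(r²(r²+a²))) · (r² − 2Mr + a²)/(r²+a²)`. In particular `χ` is
timelike exactly on `{Δ > 0}`, i.e. outside the outer horizon. [cite: Carter1968] -/
theorem kerr_bilin_carterField (M a : ℝ) {x : E4} (hx : 0 < Kerr.radius a x) :
    Kerr.bilin M a x (carterField a x) (carterField a x) =
      -((Kerr.radius a x ^ 4 + a ^ 2 * x 3 ^ 2) / (Kerr.radius a x ^ 2 * (Kerr.radius a x ^ 2 + a ^ 2)))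
        * ((Kerr.radius a x ^ 2 - 2 * M * Kerr.radius a x + a ^ 2) / (Kerr.radius a x ^ 2 + a ^ 2)) := by
  rw [Kerr.bilin_apply, minkowski_carterField, nullCovector_carterField]
  set r := Kerr.radius a x with hr
  have hkey := varpi_sq_mul_radius_sq a x
  rw [← hr] at hkey
  have hr0 : r ≠ 0 := hx.ne'
  have hra : r ^ 2 + a ^ 2 ≠ 0 := by positivity
  have hq : r ^ 4 + a ^ 2 * x 3 ^ 2 ≠ 0 := by positivity
  -- eliminate `x₁² + x₂²`
  have hw : x 1 ^ 2 + x 2 ^ 2 = (r ^ 2 + a ^ 2) * (r ^ 2 - x 3 ^ 2) / r ^ 2 := by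
    field_simp
    linear_combination hkey
  rw [hw]
  unfold Kerr.scalarH
  rw [← hr]
  field_simp
  ring

/-- **Uniform timelike margin.** If `Δ(r) = r² − 2Mr + a² ≥ 0` at a point with `r > 0`, then
`g_{M,a}(χ, χ) ≤ −r² Δ(r)/(r²+a²)²`. [cite: Carter1968] -/
theorem kerr_bilin_carterField_le (M a : ℝ) {x : E4} (hx : 0 < Kerr.radius a x)
    (hΔ : 0 ≤ Kerr.radius a x ^ 2 - 2 * M * Kerr.radius a x + a ^ 2) :
    Kerr.bilin M a x (carterField a x) (carterField a x) ≤
      -(Kerr.radius a x ^ 2 * (Kerr.radius a x ^ 2 - 2 * M * Kerr.radius a x + a ^ 2)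
        / (Kerr.radius a x ^ 2 + a ^ 2) ^ 2) := by
  rw [kerr_bilin_carterField M a hx]
  set r := Kerr.radius a x with hr
  set Δ := r ^ 2 - 2 * M * r + a ^ 2 with hΔ'
  have hra : 0 < r ^ 2 + a ^ 2 := by positivity
  -- `(r⁴ + a²z²)/(r²(r²+a²)) ≥ r²/(r²+a²)`
  have h1 : r ^ 2 / (r ^ 2 + a ^ 2) ≤ (r ^ 4 + a ^ 2 * x 3 ^ 2) / (r ^ 2 * (r ^ 2 + a ^ 2)) := by
    rw [div_le_div_iff₀ hra (by positivity)]
    nlinarith [sq_nonneg (a * x 3), sq_nonneg r, mul_nonneg (mul_nonneg (sq_nonneg (a * x 3)) (sq_nonneg r)) hra.le]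
  have h2 : 0 ≤ Δ / (r ^ 2 + a ^ 2) := div_nonneg hΔ hra.le
  have h3 := mul_le_mul_of_nonneg_right h1 h2
  have h4 : r ^ 2 / (r ^ 2 + a ^ 2) * (Δ / (r ^ 2 + a ^ 2)) = r ^ 2 * Δ / (r ^ 2 + a ^ 2) ^ 2 := by
    field_simp
  linarith

/-- `Δ(r)/(r²+a²) = 1 − 2Mr/(r²+a²)` is monotone in `r` on `[|a|, ∞) ∩ (0, ∞)` for `M ≥ 0`.
[folklore] -/
theorem kerrDelta_div_mono {M a r s : ℝ} (hM : 0 ≤ M) (hr : 0 < r) (har : |a| ≤ r) (hrs : r ≤ s) :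
    (r ^ 2 - 2 * M * r + a ^ 2) / (r ^ 2 + a ^ 2) ≤ (s ^ 2 - 2 * M * s + a ^ 2) / (s ^ 2 + a ^ 2) := by
  have ha2 : a ^ 2 = |a| ^ 2 := (sq_abs a).symm
  have hr0 : 0 ≤ r := hr.le
  have hs : 0 < s := hr.trans_le hrs
  have hra : 0 < r ^ 2 + a ^ 2 := add_pos_of_pos_of_nonneg (pow_pos hr 2) (sq_nonneg a)
  have hsa : 0 < s ^ 2 + a ^ 2 := add_pos_of_pos_of_nonneg (pow_pos hs 2) (sq_nonneg a)
  rw [div_le_div_iff₀ hra hsa]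
  -- reduces to `2M (s − r)(rs − a²) ≥ 0`
  have hkey : (s - r) * (r * s - a ^ 2) ≥ 0 := by
    apply mul_nonneg (by linarith)
    rw [ha2]
    nlinarith [mul_le_mul har (har.trans hrs) (abs_nonneg a) hr0]
  nlinarith [mul_nonneg hM hkey]

/-- `‖χ‖² ≤ 2` wherever `r > 0` (indeed `‖χ‖² = 1 + a²(x₁²+x₂²)/(r²+a²)² ≤ 1 + a²/(r²+a²)`). [folklore] -/
theorem norm_carterField_sq_le (a : ℝ) {x : E4} (hx : 0 < Kerr.radius a x) :
    ‖carterField a x‖ ^ 2 ≤ 2 := by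
  obtain ⟨h0, h1, h2, h3⟩ := carterField_apply a x
  rw [EuclideanSpace.norm_sq_eq, Fin.sum_univ_four, h0, h1, h2, h3]
  simp only [Real.norm_eq_abs, sq_abs]
  set r := Kerr.radius a x with hr
  have hkey := varpi_sq_mul_radius_sq a x
  rw [← hr] at hkey
  have hra : 0 < r ^ 2 + a ^ 2 := by positivity
  have hw : (x 1 ^ 2 + x 2 ^ 2) ≤ r ^ 2 + a ^ 2 := by
    have : (x 1 ^ 2 + x 2 ^ 2) * r ^ 2 ≤ (r ^ 2 + a ^ 2) * r ^ 2 := by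
      rw [hkey]; nlinarith [sq_nonneg (x 3), sq_nonneg a, sq_nonneg r]
    exact le_of_mul_le_mul_right this (by positivity)
  have h5 : (a / (r ^ 2 + a ^ 2)) ^ 2 * (x 1 ^ 2 + x 2 ^ 2) ≤ 1 := by
    rw [div_pow]
    calc a ^ 2 / (r ^ 2 + a ^ 2) ^ 2 * (x 1 ^ 2 + x 2 ^ 2)
        ≤ a ^ 2 / (r ^ 2 + a ^ 2) ^ 2 * (r ^ 2 + a ^ 2) :=
          mul_le_mul_of_nonneg_left hw (by positivity)
      _ = a ^ 2 / (r ^ 2 + a ^ 2) := by field_simp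
      _ ≤ 1 := by rw [div_le_one hra]; nlinarith [sq_nonneg r]
  nlinarith [h5]

/-! ### The flow of the Carter field -/

open Summit.FinalStateConjecture.FinalStateConjecture.Theorems.InertialRecession.Negative in
/-- **The Carter flow** through `x`: `s ↦ R_{ω s} x + s e₀` with `ω = a/(r(x)²+a²)` and `R_θ` the
rotation about the spin axis (`rotCLM`): time translation by `s` combined with a rotation by the
angle `ω s`. It preserves the Kerr–Schild radius and its velocity is the Carter field. [cite: Carter1968] -/
def carterFlow (a : ℝ) (x : E4) (s : ℝ) : E4 :=
  rotCLM (a / (Kerr.radius a x ^ 2 + a ^ 2) * s) x + s • E4.basisVector 0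

open Summit.FinalStateConjecture.FinalStateConjecture.Theorems.InertialRecession.Negative in
/-- Components of the Carter flow. [folklore] -/
theorem carterFlow_apply (a : ℝ) (x : E4) (s : ℝ) :
    carterFlow a x s 0 = x 0 + s ∧
      carterFlow a x s 1 = Real.cos (a / (Kerr.radius a x ^ 2 + a ^ 2) * s) * x 1 -
        Real.sin (a / (Kerr.radius a x ^ 2 + a ^ 2) * s) * x 2 ∧
      carterFlow a x s 2 = Real.sin (a / (Kerr.radius a x ^ 2 + a ^ 2) * s) * x 1 +
        Real.cos (a / (Kerr.radius a x ^ 2 + a ^ 2) * s) * x 2 ∧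
      carterFlow a x s 3 = x 3 := by
  refine ⟨?_, ?_, ?_, ?_⟩ <;> simp [carterFlow]

/-- The Carter flow starts at `x`. [folklore] -/
theorem carterFlow_zero (a : ℝ) (x : E4) : carterFlow a x 0 = x := by
  obtain ⟨h0, h1, h2, h3⟩ := carterFlow_apply a x 0
  simp only [mul_zero, Real.cos_zero, one_mul, Real.sin_zero, zero_mul, sub_zero, zero_add,
    add_zero] at h0 h1 h2 h3
  ext k
  fin_cases k
  · exact h0
  · exact h1
  · exact h2
  · exact h3

/-- The spatial part of the Carter flow is the rotated spatial part (the time translation is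
invisible to `E4.spatial`). [folklore] -/
theorem spatial_carterFlow (a : ℝ) (x : E4) (s : ℝ) :
    E4.spatial (carterFlow a x s) = E4.spatial
      (Summit.FinalStateConjecture.FinalStateConjecture.Theorems.InertialRecession.Negative.rotCLM
        (a / (Kerr.radius a x ^ 2 + a ^ 2) * s) x) := by
  rw [carterFlow, map_add, map_smul]
  have h : E4.spatial (E4.basisVector 0) = 0 := by
    ext i
    fin_cases i <;> simp
  rw [h, smul_zero, add_zero]

open Summit.FinalStateConjecture.FinalStateConjecture.Theorems.InertialRecession.Negative in
/-- **The Carter flow preserves the Kerr–Schild radius.** [cite: Carter1968] -/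
theorem radius_carterFlow (a : ℝ) (x : E4) (s : ℝ) :
    Kerr.radius a (carterFlow a x s) = Kerr.radius a x := by
  rw [Kerr.radius_eq_of_spatial_eq a (spatial_carterFlow a x s), radius_rotCLM]

open Summit.FinalStateConjecture.FinalStateConjecture.Theorems.InertialRecession.Negative in
/-- **The velocity of the Carter flow is the Carter field** at the current point. [cite: Carter1968] -/
theorem hasDerivAt_carterFlow (a : ℝ) (x : E4) (s : ℝ) :
    HasDerivAt (carterFlow a x) (carterField a (carterFlow a x s)) s := by
  set ω : ℝ := a / (Kerr.radius a x ^ 2 + a ^ 2) with hω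
  have hω' : a / (Kerr.radius a (carterFlow a x s) ^ 2 + a ^ 2) = ω := by
    rw [radius_carterFlow]
  -- derivative of the rotation factor
  have h1 : HasDerivAt (fun s ↦ rotCLM (ω * s)) (ω • rotCLM' (ω * s)) s := by
    have := (hasDerivAt_rotCLM (ω * s)).scomp s ((hasDerivAt_id s).const_mul ω)
    simp only [mul_one] at this
    exact this
  have h2 : HasDerivAt (fun s ↦ rotCLM (ω * s) x) ((ω • rotCLM' (ω * s)) x) s := by
    simpa using h1.clm_apply (hasDerivAt_const s x)
  have h3 : HasDerivAt (fun s : ℝ ↦ s • E4.basisVector 0) ((1 : ℝ) • E4.basisVector 0) s :=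
    (hasDerivAt_id s).smul_const _
  have hfun : carterFlow a x = fun s ↦ rotCLM (ω * s) x + s • E4.basisVector 0 := by
    funext s
    rw [carterFlow, ← hω]
  have h4 : HasDerivAt (carterFlow a x) ((ω • rotCLM' (ω * s)) x + (1 : ℝ) • E4.basisVector 0) s := by
    rw [hfun]
    exact h2.add h3
  -- identify the velocity with the Carter field at the current point
  have heq : (ω • rotCLM' (ω * s)) x + (1 : ℝ) • E4.basisVector 0 = carterField a (carterFlow a x s) := by
    obtain ⟨c0, c1, c2, c3⟩ := carterField_apply a (carterFlow a x s)
    obtain ⟨f0, f1, f2, f3⟩ := carterFlow_apply a x s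
    rw [hω'] at c1 c2
    rw [← hω] at f1 f2
    ext k
    fin_cases k
    · simp [c0]
    · simp only [Fin.mk_one, Fin.isValue]
      rw [c1, f2]
      simp
      ring
    · simp only [Fin.reduceFinMk, Fin.isValue]
      rw [c2, f1]
      simp
    · simp only [Fin.reduceFinMk, Fin.isValue]
      rw [c3]
      simp
  rw [← heq]
  exact h4

/-- The Carter flow is differentiable (indeed smooth) in the flow parameter. [folklore] -/
theorem differentiable_carterFlow (a : ℝ) (x : E4) : Differentiable ℝ (carterFlow a x) :=
  fun s ↦ (hasDerivAt_carterFlow a x s).differentiableAt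

/-- The Carter flow is continuous in the flow parameter. [folklore] -/
theorem continuous_carterFlow (a : ℝ) (x : E4) : Continuous (carterFlow a x) :=
  (differentiable_carterFlow a x).continuous

/-- Registered one-line form (worker carrier `rechart_carterField_timelike`) of
`kerr_bilin_carterField_le`, with the Carter field written out. [cite: Carter1968] -/
theorem rechart_carterField_timelike : open Literature.Geometry.Lorentzian in ∀ (M a : ℝ) (x : E4), 0 < Kerr.radius a x → 0 ≤ Kerr.radius a x ^ 2 - 2 * M * Kerr.radius a x + a ^ 2 → Kerr.bilin M a x (E4.basisVector 0 + (a / (Kerr.radius a x ^ 2 + a ^ 2)) • ((x 1) • E4.basisVector 2 - (x 2) • E4.basisVector 1)) (E4.basisVector 0 + (a / (Kerr.radius a x ^ 2 + a ^ 2)) • ((x 1) • E4.basisVector 2 - (x 2) • E4.basisVector 1)) ≤ -(Kerr.radius a x ^ 2 * (Kerr.radius a x ^ 2 - 2 * M * Kerr.radius a x + a ^ 2) / (Kerr.radius a x ^ 2 + a ^ 2) ^ 2) :=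
  fun M a _ hx hΔ ↦ kerr_bilin_carterField_le M a hx hΔ

end Summit.FinalStateConjecture.FinalStateConjecture.Theorems.SublinearIsFree.Rechart

end
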